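import Summits.BirchSwinnertonDyer.BirchSwinnertonDyer.Theses.ShaPrimaryTransfer
import Literature.NumberTheory.EllipticCurves.XCubeAddDXSharpRankSha
import Literature.NumberTheory.EllipticCurves.XCubeSub82XRankThree

/-!
# BirchSwinnertonDyer / ShaPrimaryTransfer — crux `FiniteShaComponentTransfer` (stmt-BirchSwinnertonDyer-22356):
# the door at 2 is open in the kernel at RANK 5 — `E : y² = x³ − 361202x` has `rank E(ℚ) = 5` and `Ш(E/ℚ)[2] = 0`

Route `ShaPrimaryTransfer` (D-0145 LINE 2): T = `FiniteShaComponentTransfer` (stmt-22356: «`t_p(E) = 0 ⟹ t_q(E) = 0`»,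
`t_p(E) = corank_{ℤ_p} Ш(E)[p^∞]`), whose door at `2` is decided curve by curve by complete `2`-descent. The companions
certify the door at `2` in the kernel at ranks `0, 1, 2` (`…OneFiniteShaComponentKernelDoors`), `3` (`…KernelRankThree`,
`…NonCMRankThreeDoor`, `Literature/…/XCubeSub82XShaTwo`). This helper file (prover seat `bsd-line-spt-p1` g5, `--supports
stmt-22356 --as helper`) pushes the kernel to RANK 5 with the same instrument:

  `E : y² = x³ − 361202x`,  `361202 = 2·313·577 = 601² + 1`,  `E' : y² = x³ + 1444808x`.

The descent via `2`-isogeny is SHARP on both sides: the rational points `(−1, 601)`, `(−288, 8952)`, `(−313, 9077)`,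
`(−577, 4039)` of `E` give `α = [−1], [−2], [−313], [−577]`, so `α(E(ℚ))` is all of `{± d : d ∣ 361202}` (16 classes);
the points `(288, 20976)`, `(22536, 3387912)` and `T'` of `E'` give `ᾱ = [2], [626], [361202]`, so `ᾱ(E'(ℚ))` is all
eight positive classes. Hence `2^{rank+2} = #α · #ᾱ ≥ 2⁷` (Silverman–Tate, tree `natCard_range_xSqClass_mul`), while
`rank ≤ ν(361202) + ν(722404) − 1 = 5` (Silverman X.6.1(b) sharpened, tree `XCubeAddDX.mordellWeilRank_le_add`):
**`rank E(ℚ) = 5`**, and since the bound is attained both `φ`-parts of `Ш` vanish (tree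
`forall_mem_sha_two_smul_eq_zero_xD_of_rank_eq`, X.4.7): **`Ш(E/ℚ)[2] = 0`**, `t_2(E) = 0`, `corank_{ℤ_2} Sel_{2^∞}(E/ℚ) = 5`.

* `natCard_range_xSqClass_E_ge` (`#α ≥ 16`), `natCard_range_xSqClass_E'_ge` (`#ᾱ ≥ 8`), `card_primeFactors_361202`;
* **`mordellWeilRank_eq_five`**, `mordellWeilRank_eq_bound`, **`forall_mem_sha_two_smul_eq_zero`** (`Ш[2] = 0`),
  **`door_at_two_rank_five`** (`rank = 5 ∧ t_2 = 0`), **`selmerCorank_two_eq_five`**, `oneFiniteShaComponent_E` (O for `E`),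
  `exists_transfer_hypothesis_rank_five`;
* T BY NAME: `selmerCorank_eq_five_of_transfer` — granting T, `t_q(E) = 0` and `corank Sel_{q^∞}(E) = 5` at every prime `q`.

Everything is UNCONDITIONAL (standard axioms, no named fact, no `L`-function, no local insolubility argument — the example
was chosen, by a seconds-long search, so that the rational points fill the a-priori Selmer bounds). In this tree exact
ranks had been certified up to `4` (`CongruentNumberCurve29274Selmer`; `rankFiveWitness` gives only `5 ≤ rank`); here
rank EXACTLY `5` together with `Ш[2] = 0` comes out in ~300 lines. Nothing here proves T, O or BSD; T is conjecture-grade at rank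
≥ 2, and T's CONCLUSION (all `t_q = 0`) is certified for no curve of rank ≥ 2. (`E` has CM by `ℤ[i]`, `j = 1728`; a
non-CM rank-3 door is in `…NonCMRankThreeDoor`.) References: J. H. Silverman, *AEC* 2nd ed., X.4.7, X.4.9, X.6.1;
J. H. Silverman, J. Tate, *Rational Points on Elliptic Curves*, §3.5–3.6; R. Greenberg, LNM 1716 (1999), §1.
-/

-- D-0017: single-problem summit, so `Summit.BirchSwinnertonDyer.BirchSwinnertonDyer.…` repeats a namespace BY DESIGN.
set_option linter.dupNamespace false

noncomputable section

namespace Summit.BirchSwinnertonDyer.BirchSwinnertonDyer.Theorems.ShaPrimaryTransferKernelRankFive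

open scoped Classical
open Literature.NumberTheory.EllipticCurves Literature.NumberTheory.EllipticCurves.XCubeAddDX
open WeierstrassCurve WeierstrassCurve.Affine
open Summit.BirchSwinnertonDyer.BirchSwinnertonDyer.Theses.ShaPrimaryTransfer (FiniteShaComponentTransfer)

/-! ## §0 Bookkeeping (`n = 361202 = 2·313·577 = 601² + 1`, `4n = 1444808`) -/

/-- `b(a² − 4b) ≠ 0` for `(a, b) = (0, −361202)`. [folklore] -/
private theorem hab5 : (-361202 : ℤ) * ((0 : ℤ) ^ 2 - 4 * (-361202)) ≠ 0 := by norm_num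

/-- The tree's literal `E_{0,−361202}` is `⟨0, 0, 0, −361202, 0⟩`. [folklore] -/
private theorem lit_E : (⟨0, ((0 : ℤ) : ℚ), 0, ((-361202 : ℤ) : ℚ), 0⟩ : WeierstrassCurve ℚ) = ⟨0, 0, 0, -361202, 0⟩ := by
  ext <;> push_cast <;> ring

/-- The literal `⟨0, 0, 0, ((−361202 : ℤ) : ℚ), 0⟩` is `⟨0, 0, 0, −361202, 0⟩`. [folklore] -/
private theorem lit_E₀ : (⟨0, 0, 0, ((-361202 : ℤ) : ℚ), 0⟩ : WeierstrassCurve ℚ) = ⟨0, 0, 0, -361202, 0⟩ := by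
  ext <;> push_cast <;> ring

/-- The tree's literal `E'_{0,−361202} = E_{0, 1444808}` is `⟨0, 0, 0, 1444808, 0⟩`. [folklore] -/
private theorem lit_E' :
    (⟨0, ((-2 * 0 : ℤ) : ℚ), 0, (((0 : ℤ) ^ 2 - 4 * (-361202) : ℤ) : ℚ), 0⟩ : WeierstrassCurve ℚ) = ⟨0, 0, 0, 1444808, 0⟩ := by
  ext <;> push_cast <;> ring

/-- `E : y² = x³ − 361202x` is an elliptic curve. [folklore] -/
theorem isElliptic_E : (⟨0, 0, 0, -361202, 0⟩ : WeierstrassCurve ℚ).IsElliptic := by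
  rw [← lit_E]; exact isElliptic_mk_of_ne_zero (F := ℚ) hab5

/-- `E' : y² = x³ + 1444808x` is an elliptic curve. [folklore] -/
theorem isElliptic_E' : (⟨0, 0, 0, 1444808, 0⟩ : WeierstrassCurve ℚ).IsElliptic := by
  rw [← lit_E']; exact isElliptic_mk_of_ne_zero (F := ℚ) (twoIsogenyCodomain_ne_zero hab5)

/-- Squarefree integers with the same class in `ℚ*/ℚ*²` are equal. [folklore] -/
private theorem eq_of_sqClass_intCast_eq {d₁ d₂ : ℤ} (h₁ : Squarefree d₁) (h₂ : Squarefree d₂)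
    (he : sqClass (d₁ : ℚ) = sqClass (d₂ : ℚ)) : d₁ = d₂ := by
  have h0₁ : (d₁ : ℚ) ≠ 0 := by exact_mod_cast h₁.ne_zero
  have h0₂ : (d₂ : ℚ) ≠ 0 := by exact_mod_cast h₂.ne_zero
  have h1 : sqClass ((d₁ : ℚ) * d₂) = 1 := by rw [sqClass_mul h0₁ h0₂, he, SqUnits.mul_self]
  obtain ⟨u, hu⟩ := (sqClass_eq_one_iff (mul_ne_zero h0₁ h0₂)).mp h1
  obtain ⟨m, hm⟩ : IsSquare (d₁ * d₂) := by
    rw [← Rat.isSquare_intCast_iff]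
    exact ⟨u, by push_cast; rw [hu, pow_two]⟩
  exact eq_of_squarefree_of_mul_eq_sq h₁ h₂ (m := m) (by rw [hm, pow_two])

/-- Squarefreeness of an integer from the factorisation of its absolute value. [folklore] -/
private theorem squarefree_int_of_natAbs {d : ℤ} {n : ℕ} (h : d.natAbs = n) (hn : n ≠ 0)
    (hnd : n.primeFactorsList.Nodup) : Squarefree d :=
  Int.squarefree_natAbs.mp (h ▸ (Nat.squarefree_iff_nodup_primeFactorsList hn).mpr hnd)

/-- A rational solution of `y² = x³ + bx` with `x ≠ 0` puts `[x]` into `α(E_{0,b}(ℚ))`. [folklore] -/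
private theorem sqClass_mem_range_of_eq {b x y : ℚ} [(⟨0, 0, 0, b, 0⟩ : WeierstrassCurve ℚ).IsElliptic]
    (hy : y ^ 2 = x ^ 3 + b * x) (hx : x ≠ 0) : sqClass x ∈ Set.range (⟨0, 0, 0, b, 0⟩ : WeierstrassCurve ℚ).xSqClass := by
  have hns : (⟨0, 0, 0, b, 0⟩ : WeierstrassCurve ℚ).toAffine.Nonsingular x y := by
    refine Affine.equation_iff_nonsingular.mp ?_
    rw [Affine.equation_iff]
    show y ^ 2 + 0 * x * y + 0 * y = x ^ 3 + 0 * x ^ 2 + b * x + 0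
    linear_combination hy
  exact ⟨.some x y hns, xSqClass_some_of_ne_zero _ hx⟩

/-- `[x t²] = [x]` in `ℚ*/ℚ*²`. [folklore] -/
private theorem sqClass_mul_sq' {x t : ℚ} (hx : x ≠ 0) (ht : t ≠ 0) : sqClass (x * t ^ 2) = sqClass x := by
  rw [sqClass_mul hx (pow_ne_zero 2 ht), sqClass_sq, mul_one]

/-- `313` and `577` are prime. [folklore] -/
private theorem prime_313 : Nat.Prime 313 := by norm_num
/-- `577` is prime. [folklore] -/
private theorem prime_577 : Nat.Prime 577 := by norm_num

/-! ## §1 `#α(E(ℚ)) ≥ 16`: the points `(−1, 601)`, `(−288, 8952)`, `(−313, 9077)`, `(−577, 4039)` -/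

/-- **`#α(E(ℚ)) ≥ 16` for `E : y² = x³ − 361202x`**: the rational points `(−1, 601)`, `(−288, 8952)`, `(−313, 9077)`,
`(−577, 4039)` have `α = [−1], [−2], [−313], [−577]`; `α(E(ℚ))` is a group, so it contains all sixteen classes
`{± d : d ∣ 361202 squarefree}` (`361202 = 2·313·577`). UNCONDITIONAL. [cite: SilvermanTate2015, §3.5–3.6 (α(x,y) = x mod ℚ*²; 2^r = #α(Γ)·#ᾱ(Γ̄)/4)] -/
theorem natCard_range_xSqClass_E_ge :
    (Set.range (⟨0, 0, 0, -361202, 0⟩ : WeierstrassCurve ℚ).xSqClass).Finite ∧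
      16 ≤ Nat.card (Set.range (⟨0, 0, 0, -361202, 0⟩ : WeierstrassCurve ℚ).xSqClass) := by
  haveI := isElliptic_E
  set W := (⟨0, 0, 0, -361202, 0⟩ : WeierstrassCurve ℚ) with hW
  have hfin : (Set.range W.xSqClass).Finite := by
    have h := (natCard_range_xSqClass_le (a := 0) (b := -361202) hab5).1
    rw [lit_E] at h
    exact h
  refine ⟨hfin, ?_⟩
  have mul : ∀ {x y : ℚ}, x ≠ 0 → y ≠ 0 → sqClass x ∈ Set.range W.xSqClass → sqClass y ∈ Set.range W.xSqClass →
      sqClass (x * y) ∈ Set.range W.xSqClass := by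
    intro x y hx hy h₁ h₂
    rw [sqClass_mul hx hy]
    exact mul_mem_range_xSqClass W h₁ h₂
  have g0 : sqClass (1 : ℚ) ∈ Set.range W.xSqClass :=
    ⟨0, by rw [xSqClass_zero]; exact ((sqClass_eq_one_iff one_ne_zero).mpr ⟨1, by norm_num⟩).symm⟩
  have gm1 : sqClass (-1 : ℚ) ∈ Set.range W.xSqClass :=
    sqClass_mem_range_of_eq (x := -1) (y := 601) (by norm_num) (by norm_num)
  have gm2 : sqClass (-2 : ℚ) ∈ Set.range W.xSqClass := by
    have h := sqClass_mem_range_of_eq (b := -361202) (x := -288) (y := 8952) (by norm_num) (by norm_num)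
    rwa [show (-288 : ℚ) = -2 * 12 ^ 2 by norm_num, sqClass_mul_sq' (by norm_num) (by norm_num)] at h
  have gm313 : sqClass (-313 : ℚ) ∈ Set.range W.xSqClass :=
    sqClass_mem_range_of_eq (x := -313) (y := 9077) (by norm_num) (by norm_num)
  have gm577 : sqClass (-577 : ℚ) ∈ Set.range W.xSqClass :=
    sqClass_mem_range_of_eq (x := -577) (y := 4039) (by norm_num) (by norm_num)
  -- derived classes
  have g2 : sqClass (2 : ℚ) ∈ Set.range W.xSqClass := by
    have h := mul (by norm_num) (by norm_num) gm1 gm2; norm_num at h; exact h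
  have g313 : sqClass (313 : ℚ) ∈ Set.range W.xSqClass := by
    have h := mul (by norm_num) (by norm_num) gm1 gm313; norm_num at h; exact h
  have g577 : sqClass (577 : ℚ) ∈ Set.range W.xSqClass := by
    have h := mul (by norm_num) (by norm_num) gm1 gm577; norm_num at h; exact h
  have g626 : sqClass (626 : ℚ) ∈ Set.range W.xSqClass := by
    have h := mul (by norm_num) (by norm_num) g2 g313; norm_num at h; exact h
  have g1154 : sqClass (1154 : ℚ) ∈ Set.range W.xSqClass := by
    have h := mul (by norm_num) (by norm_num) g2 g577; norm_num at h; exact h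
  have g180601 : sqClass (180601 : ℚ) ∈ Set.range W.xSqClass := by
    have h := mul (by norm_num) (by norm_num) g313 g577; norm_num at h; exact h
  have g361202 : sqClass (361202 : ℚ) ∈ Set.range W.xSqClass := by
    have h := mul (by norm_num) (by norm_num) g2 g180601; norm_num at h; exact h
  have neg : ∀ {x : ℚ}, x ≠ 0 → sqClass x ∈ Set.range W.xSqClass → sqClass (-x) ∈ Set.range W.xSqClass := by
    intro x hx h
    have h' := mul (by norm_num) hx gm1 h
    rwa [neg_one_mul] at h'
  set C : Finset ℤ := {1, -1, 2, -2, 313, -313, 577, -577, 626, -626, 1154, -1154, 180601, -180601, 361202, -361202}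
    with hC
  have hsqf : ∀ d ∈ C, Squarefree d := by
    intro d hd
    simp only [hC, Finset.mem_insert, Finset.mem_singleton] at hd
    rcases hd with rfl | rfl | rfl | rfl | rfl | rfl | rfl | rfl | rfl | rfl | rfl | rfl | rfl | rfl | rfl | rfl
    · exact squarefree_int_of_natAbs (n := 1) rfl one_ne_zero (by simp)
    · exact squarefree_int_of_natAbs (n := 1) rfl one_ne_zero (by simp)
    · exact squarefree_int_of_natAbs (n := 2) rfl two_ne_zero (by simp)
    · exact squarefree_int_of_natAbs (n := 2) rfl two_ne_zero (by simp)
    · exact squarefree_int_of_natAbs (n := 313) rfl (by norm_num) (by simp)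
    · exact squarefree_int_of_natAbs (n := 313) rfl (by norm_num) (by simp)
    · exact squarefree_int_of_natAbs (n := 577) rfl (by norm_num) (by simp)
    · exact squarefree_int_of_natAbs (n := 577) rfl (by norm_num) (by simp)
    · exact squarefree_int_of_natAbs (n := 626) rfl (by norm_num) (by simp)
    · exact squarefree_int_of_natAbs (n := 626) rfl (by norm_num) (by simp)
    · exact squarefree_int_of_natAbs (n := 1154) rfl (by norm_num) (by simp)
    · exact squarefree_int_of_natAbs (n := 1154) rfl (by norm_num) (by simp)
    · exact squarefree_int_of_natAbs (n := 180601) rfl (by norm_num) (by simp)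
    · exact squarefree_int_of_natAbs (n := 180601) rfl (by norm_num) (by simp)
    · exact squarefree_int_of_natAbs (n := 361202) rfl (by norm_num) (by simp)
    · exact squarefree_int_of_natAbs (n := 361202) rfl (by norm_num) (by simp)
  have hsub : (↑(C.image fun d : ℤ => sqClass (d : ℚ)) : Set (SqUnits ℚ)) ⊆ Set.range W.xSqClass := by
    intro c hc
    obtain ⟨d, hd, rfl⟩ := Finset.mem_image.mp (Finset.mem_coe.mp hc)
    simp only [hC, Finset.mem_insert, Finset.mem_singleton] at hd
    rcases hd with rfl | rfl | rfl | rfl | rfl | rfl | rfl | rfl | rfl | rfl | rfl | rfl | rfl | rfl | rfl | rfl <;>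
      push_cast
    · exact g0
    · exact gm1
    · exact g2
    · exact gm2
    · exact g313
    · exact gm313
    · exact g577
    · exact gm577
    · exact g626
    · exact neg (by norm_num) g626
    · exact g1154
    · exact neg (by norm_num) g1154
    · exact g180601
    · exact neg (by norm_num) g180601
    · exact g361202
    · exact neg (by norm_num) g361202
  have hcard : (C.image fun d : ℤ => sqClass (d : ℚ)).card = 16 := by
    rw [Finset.card_image_of_injOn (fun d₁ h₁ d₂ h₂ he => eq_of_sqClass_intCast_eq (hsqf d₁ h₁) (hsqf d₂ h₂) he)]
    rfl
  calc 16 = (↑(C.image fun d : ℤ => sqClass (d : ℚ)) : Set (SqUnits ℚ)).ncard := by rw [Set.ncard_coe_finset, hcard]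
    _ ≤ (Set.range W.xSqClass).ncard := Set.ncard_le_ncard hsub hfin
    _ = Nat.card (Set.range W.xSqClass) := (Nat.card_coe_set_eq _).symm

/-! ## §2 `#ᾱ(E'(ℚ)) ≥ 8`: the points `(288, 20976)`, `(22536, 3387912)` and `T'` -/

/-- **`#ᾱ(E'(ℚ)) ≥ 8` for `E' : y² = x³ + 1444808x`**: `ᾱ(288, 20976) = [2]`, `ᾱ(22536, 3387912) = [626]`,
`ᾱ(T') = [1444808] = [361202]`, and products: all eight classes `[d]`, `d ∣ 361202` squarefree, `d > 0`. UNCONDITIONAL.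
[cite: SilvermanTate2015, §3.5–3.6 (α(T) = b mod ℚ*²)] -/
theorem natCard_range_xSqClass_E'_ge :
    (Set.range (⟨0, 0, 0, 1444808, 0⟩ : WeierstrassCurve ℚ).xSqClass).Finite ∧
      8 ≤ Nat.card (Set.range (⟨0, 0, 0, 1444808, 0⟩ : WeierstrassCurve ℚ).xSqClass) := by
  haveI := isElliptic_E'
  set W := (⟨0, 0, 0, 1444808, 0⟩ : WeierstrassCurve ℚ) with hW
  have hfin : (Set.range W.xSqClass).Finite := by
    have h := (natCard_range_xSqClass_le (a := -2 * 0) (b := (0 : ℤ) ^ 2 - 4 * (-361202))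
      (twoIsogenyCodomain_ne_zero hab5)).1
    rw [lit_E'] at h
    exact h
  refine ⟨hfin, ?_⟩
  have mul : ∀ {x y : ℚ}, x ≠ 0 → y ≠ 0 → sqClass x ∈ Set.range W.xSqClass → sqClass y ∈ Set.range W.xSqClass →
      sqClass (x * y) ∈ Set.range W.xSqClass := by
    intro x y hx hy h₁ h₂
    rw [sqClass_mul hx hy]
    exact mul_mem_range_xSqClass W h₁ h₂
  have g0 : sqClass (1 : ℚ) ∈ Set.range W.xSqClass :=
    ⟨0, by rw [xSqClass_zero]; exact ((sqClass_eq_one_iff one_ne_zero).mpr ⟨1, by norm_num⟩).symm⟩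
  have g2 : sqClass (2 : ℚ) ∈ Set.range W.xSqClass := by
    have h := sqClass_mem_range_of_eq (b := 1444808) (x := 288) (y := 20976) (by norm_num) (by norm_num)
    rwa [show (288 : ℚ) = 2 * 12 ^ 2 by norm_num, sqClass_mul_sq' (by norm_num) (by norm_num)] at h
  have g626 : sqClass (626 : ℚ) ∈ Set.range W.xSqClass := by
    have h := sqClass_mem_range_of_eq (b := 1444808) (x := 22536) (y := 3387912) (by norm_num) (by norm_num)
    rwa [show (22536 : ℚ) = 626 * 6 ^ 2 by norm_num, sqClass_mul_sq' (by norm_num) (by norm_num)] at h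
  have gT : sqClass (361202 : ℚ) ∈ Set.range W.xSqClass := by
    refine ⟨W.twoTorsionPoint, ?_⟩
    rw [xSqClass_twoTorsionPoint]
    show sqClass (1444808 : ℚ) = _
    rw [show (1444808 : ℚ) = 361202 * 2 ^ 2 by norm_num, sqClass_mul_sq' (by norm_num) two_ne_zero]
  have g313 : sqClass (313 : ℚ) ∈ Set.range W.xSqClass := by
    have h := mul (by norm_num) (by norm_num) g2 g626
    rwa [show (2 : ℚ) * 626 = 313 * 2 ^ 2 by norm_num, sqClass_mul_sq' (by norm_num) two_ne_zero] at h
  have g577 : sqClass (577 : ℚ) ∈ Set.range W.xSqClass := by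
    have h := mul (by norm_num) (by norm_num) g626 gT
    rwa [show (626 : ℚ) * 361202 = 577 * 626 ^ 2 by norm_num, sqClass_mul_sq' (by norm_num) (by norm_num)] at h
  have g1154 : sqClass (1154 : ℚ) ∈ Set.range W.xSqClass := by
    have h := mul (by norm_num) (by norm_num) g2 g577; norm_num at h; exact h
  have g180601 : sqClass (180601 : ℚ) ∈ Set.range W.xSqClass := by
    have h := mul (by norm_num) (by norm_num) g313 g577; norm_num at h; exact h
  set C : Finset ℤ := {1, 2, 313, 577, 626, 1154, 180601, 361202} with hC
  have hsqf : ∀ d ∈ C, Squarefree d := by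
    intro d hd
    simp only [hC, Finset.mem_insert, Finset.mem_singleton] at hd
    rcases hd with rfl | rfl | rfl | rfl | rfl | rfl | rfl | rfl
    · exact squarefree_int_of_natAbs (n := 1) rfl one_ne_zero (by simp)
    · exact squarefree_int_of_natAbs (n := 2) rfl two_ne_zero (by simp)
    · exact squarefree_int_of_natAbs (n := 313) rfl (by norm_num) (by simp)
    · exact squarefree_int_of_natAbs (n := 577) rfl (by norm_num) (by simp)
    · exact squarefree_int_of_natAbs (n := 626) rfl (by norm_num) (by simp)
    · exact squarefree_int_of_natAbs (n := 1154) rfl (by norm_num) (by simp)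
    · exact squarefree_int_of_natAbs (n := 180601) rfl (by norm_num) (by simp)
    · exact squarefree_int_of_natAbs (n := 361202) rfl (by norm_num) (by simp)
  have hsub : (↑(C.image fun d : ℤ => sqClass (d : ℚ)) : Set (SqUnits ℚ)) ⊆ Set.range W.xSqClass := by
    intro c hc
    obtain ⟨d, hd, rfl⟩ := Finset.mem_image.mp (Finset.mem_coe.mp hc)
    simp only [hC, Finset.mem_insert, Finset.mem_singleton] at hd
    rcases hd with rfl | rfl | rfl | rfl | rfl | rfl | rfl | rfl <;> push_cast
    · exact g0
    · exact g2
    · exact g313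
    · exact g577
    · exact g626
    · exact g1154
    · exact g180601
    · exact gT
  have hcard : (C.image fun d : ℤ => sqClass (d : ℚ)).card = 8 := by
    rw [Finset.card_image_of_injOn (fun d₁ h₁ d₂ h₂ he => eq_of_sqClass_intCast_eq (hsqf d₁ h₁) (hsqf d₂ h₂) he)]
    rfl
  calc 8 = (↑(C.image fun d : ℤ => sqClass (d : ℚ)) : Set (SqUnits ℚ)).ncard := by rw [Set.ncard_coe_finset, hcard]
    _ ≤ (Set.range W.xSqClass).ncard := Set.ncard_le_ncard hsub hfin
    _ = Nat.card (Set.range W.xSqClass) := (Nat.card_coe_set_eq _).symm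

/-! ## §3 `rank E(ℚ) = 5`, `Ш(E/ℚ)[2] = 0`, `t_2(E) = 0`, `corank Sel_{2^∞}(E/ℚ) = 5` -/

/-- `ν(361202) = 3` and `ν(722404) = 3` (`361202 = 2·313·577`): the bound `ν(D) + ν(2D) − 1` of the descent is `5`. [folklore] -/
theorem card_primeFactors_361202 :
    (-361202 : ℤ).natAbs.primeFactors.card = 3 ∧ (2 * (-361202 : ℤ)).natAbs.primeFactors.card = 3 := by
  rw [show (-361202 : ℤ).natAbs = 361202 from rfl, show (2 * (-361202 : ℤ)).natAbs = 722404 from rfl]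
  constructor <;> simp [Nat.primeFactors]

/-- **`rank E(ℚ) = 5` for `E : y² = x³ − 361202x`**, UNCONDITIONALLY: `2^{rank + 2} = #α(E(ℚ)) · #ᾱ(E'(ℚ)) ≥ 16 · 8 = 2⁷`
(Silverman–Tate, tree `natCard_range_xSqClass_mul`) and `rank ≤ ν(361202) + ν(722404) − 1 = 5` (Silverman X.6.1(b)
sharpened, tree `XCubeAddDX.mordellWeilRank_le_add`). [cite: SilvermanTate2015, §3.6 (2^r = #α(Γ)·#ᾱ(Γ̄)/4)] [cite: SilvermanAEC2009, Prop. X.6.1(b)] -/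
theorem mordellWeilRank_eq_five : (⟨0, 0, 0, -361202, 0⟩ : WeierstrassCurve ℚ).mordellWeilRank = 5 := by
  haveI hE := isElliptic_mk_of_ne_zero (F := ℚ) hab5
  have key := natCard_range_xSqClass_mul (⟨0, ((0 : ℤ) : ℚ), 0, ((-361202 : ℤ) : ℚ), 0⟩ : WeierstrassCurve ℚ)
  rw [twoIsogenyCodomain_mk_intCast 0 (-361202 : ℤ), lit_E', lit_E] at key
  obtain ⟨-, h16⟩ := natCard_range_xSqClass_E_ge
  obtain ⟨-, h8⟩ := natCard_range_xSqClass_E'_ge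
  have h128 : 2 ^ 7 ≤ 2 ^ ((⟨0, 0, 0, -361202, 0⟩ : WeierstrassCurve ℚ).mordellWeilRank + 2) := by
    rw [← key]
    exact le_trans (by norm_num) (Nat.mul_le_mul h16 h8)
  have hge : 7 ≤ (⟨0, 0, 0, -361202, 0⟩ : WeierstrassCurve ℚ).mordellWeilRank + 2 :=
    (Nat.pow_le_pow_iff_right Nat.one_lt_two).mp h128
  have hle := XCubeAddDX.mordellWeilRank_le_add (D := -361202) (by norm_num)
  rw [card_primeFactors_361202.1, card_primeFactors_361202.2, lit_E₀] at hle
  omega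

/-- `rank E(ℚ) = ν(D) + ν(2D) − 1` for `D = −361202`: the descent bound is attained. [cite: SilvermanAEC2009, Prop. X.6.1(b)] -/
theorem mordellWeilRank_eq_bound :
    (⟨0, 0, 0, ((-361202 : ℤ) : ℚ), 0⟩ : WeierstrassCurve ℚ).mordellWeilRank =
      (-361202 : ℤ).natAbs.primeFactors.card + (2 * (-361202 : ℤ)).natAbs.primeFactors.card - 1 := by
  rw [lit_E₀, mordellWeilRank_eq_five, card_primeFactors_361202.1, card_primeFactors_361202.2]

/-- **`Ш(E/ℚ)[2] = 0` for `E : y² = x³ − 361202x`**, UNCONDITIONALLY (sharp descent: tree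
`forall_mem_sha_two_smul_eq_zero_xD_of_rank_eq`, Silverman X.4.7). [cite: SilvermanAEC2009, Prop. X.4.7 and Thm. X.4.2(a)] -/
theorem forall_mem_sha_two_smul_eq_zero :
    ∀ c ∈ (⟨0, 0, 0, -361202, 0⟩ : WeierstrassCurve ℚ).sha, 2 • c = 0 → c = 0 := by
  have h := forall_mem_sha_two_smul_eq_zero_xD_of_rank_eq (D := -361202) (by norm_num) mordellWeilRank_eq_bound
  rwa [lit_E₀] at h

/-- **The door at 2 at rank 5: `rank E(ℚ) = 5` and `t_2(E) = corank_{ℤ_2} Ш(E/ℚ)[2^∞] = 0`** for `E : y² = x³ − 361202x`.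
UNCONDITIONAL. [cite: SilvermanAEC2009, Prop. X.6.1(b) with Prop. X.4.7] [cite: Greenberg1999LNM, §1] -/
theorem door_at_two_rank_five :
    (⟨0, 0, 0, -361202, 0⟩ : WeierstrassCurve ℚ).mordellWeilRank = 5 ∧ (⟨0, 0, 0, -361202, 0⟩ : WeierstrassCurve ℚ).shaCorank 2 = 0 := by
  have h := shaCorank_two_xD_of_rank_eq (D := -361202) (by norm_num) mordellWeilRank_eq_bound
  rw [lit_E₀] at h
  exact ⟨mordellWeilRank_eq_five, h⟩

/-- **`corank_{ℤ_2} Sel_{2^∞}(E/ℚ) = 5 = rank E(ℚ)`** for `E : y² = x³ − 361202x`: T's hypothesis in Selmer coordinates,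
kernel-certified at rank 5. UNCONDITIONAL. [cite: Greenberg1999LNM, §1 pp. 54–57] -/
theorem selmerCorank_two_eq_five : (⟨0, 0, 0, -361202, 0⟩ : WeierstrassCurve ℚ).selmerCorank 2 = 5 := by
  have h := selmerCorank_two_xD_of_rank_eq (D := -361202) (by norm_num) mordellWeilRank_eq_bound
  rw [lit_E₀, mordellWeilRank_eq_five] at h
  exact h

/-- **O holds for `E : y² = x³ − 361202x`** (rank 5), witness `p₀ = 2`. UNCONDITIONAL. [cite: Greenberg1999LNM, §1] -/
theorem oneFiniteShaComponent_E :
    ∃ (q : ℕ) (_ : Fact q.Prime), (⟨0, 0, 0, -361202, 0⟩ : WeierstrassCurve ℚ).shaCorank q = 0 :=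
  ⟨2, ⟨Nat.prime_two⟩, door_at_two_rank_five.2⟩

/-- **T at the rank-5 door** (the crux BY NAME): granting T, `t_q(E) = 0` and `corank_{ℤ_q} Sel_{q^∞}(E/ℚ) = 5` at EVERY
prime `q` for `E : y² = x³ − 361202x` — unconditional at `q = 2`, certified for no odd `q`. [cite: Greenberg1999LNM, §1 pp. 54–57] -/
theorem selmerCorank_eq_five_of_transfer (hT : FiniteShaComponentTransfer) (q : ℕ) [Fact q.Prime] :
    (⟨0, 0, 0, -361202, 0⟩ : WeierstrassCurve ℚ).shaCorank q = 0 ∧ (⟨0, 0, 0, -361202, 0⟩ : WeierstrassCurve ℚ).selmerCorank q = 5 := by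
  haveI := isElliptic_E
  haveI : Fact (Nat.Prime 2) := ⟨Nat.prime_two⟩
  have h0 : (⟨0, 0, 0, -361202, 0⟩ : WeierstrassCurve ℚ).shaCorank q = 0 := hT _ 2 q door_at_two_rank_five.2
  refine ⟨h0, ?_⟩
  rw [(⟨0, 0, 0, -361202, 0⟩ : WeierstrassCurve ℚ).selmerCorank_eq_mordellWeilRank_add_holds q, mordellWeilRank_eq_five, h0]

/-- **T's hypothesis is kernel-certified at rank 5**: an elliptic `E/ℚ` with `rank = 5`, `corank Sel_{2^∞}(E) = 5`,
`t_2(E) = 0`. UNCONDITIONAL. [cite: Greenberg1999LNM, §1] -/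
theorem exists_transfer_hypothesis_rank_five :
    ∃ W : WeierstrassCurve ℚ, W.IsElliptic ∧ W.mordellWeilRank = 5 ∧ W.selmerCorank 2 = 5 ∧ W.shaCorank 2 = 0 :=
  ⟨_, isElliptic_E, mordellWeilRank_eq_five, selmerCorank_two_eq_five, door_at_two_rank_five.2⟩

end Summit.BirchSwinnertonDyer.BirchSwinnertonDyer.Theorems.ShaPrimaryTransferKernelRankFive

end
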